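import Summits.QuantumFields.QCD.Theses.HeatSlicedQuarks
import Summits.QuantumFields.QCD.Theorems.RobustYangMillsHandover.Negative.GapClauses
import Summits.QuantumFields.QCD.Theorems.RobustYangMillsHandover.Negative.ChiralityObstruction
import Summits.QuantumFields.QCD.Theorems.HeatSlicedQuarksSmallFieldUltracontractivity
import Summits.QuantumFields.QCD.Theorems.HeatSlicedQuarksActionBoundsLowModes
import Summits.QuantumFields.QCD.Theorems.HeatSlicedQuarksTracedQuadraticParametrix
import Summits.QuantumFields.QCD.Theorems.HeatSlicedQuarksQuarkLoopCoefficient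

/-!
# Strategy census s8 — kernel-checked companion (crux `RobustYangMillsHandover`, item stmt-QuantumFields-8892)

Second independent strategist seat (`cstrat-stmt-QuantumFields-8892-s8`, family `-s`).  This file holds
the Lean content behind the four headings of `STRATEGY-CENSUS-s8.md`; every theorem here is pure logic
over tree declarations (no `sorry`, no new facts):

* §1 **Weaker intermediate** — `crux_of_replacement`: ANY statement `C'` that could replace the crux as
  the last binder of a deciding theorem of the route's shape already implies the crux (the other five
  binders are theorems of the tree and the open glue item `InterleavedFlowProper` is implied by the
  target).  So no strictly weaker occupant of the slot exists; `crux_iff_qcd_of_target` records that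
  given the target the crux IS the summit conjunct.
* §2 **Decomposition** — `handover_of_latticeSide_continuumSide`: the typed seam lattice | continuum in
  the shift-allowed form (the lattice side may re-choose the regularisation), with `latticeSide_of_qcd`
  certifying that the lattice side is a consequence of the summit conjunct (it is not stronger than `S`).
* §3 **Strengthen** — `handover_of_sameRegStrong`: the rigid same-regularisation form `S⁺` implies the
  crux, and `not_sameRegStrong_of_uniformFloor`: `S⁺` is REFUTED by any target-honest regularisation
  carrying a uniform lattice floor above some threshold (the heavy-quark/decoupled regime in uniform
  form) — the added rigidity forbids exactly the overshooting witnesses the target admits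
  (`Negative.continuumQCDExists_iff_threshold`), so the honest rigid form must re-pin `m_crit`, which is
  the live line `pin_the_infimum`, not a new one.
* §4 **Negation** — `target_of_not_handover`: a refutation of the crux contains a proof of the target.
-/

namespace Summit.QuantumFields.QCD.Cruxes.RobustYangMillsHandover.CensusS8

open Literature.MathematicalPhysics.QuantumFieldTheory
open Summit.QuantumFields.QCD.Theses.HeatSlicedQuarks
open Summit.QuantumFields.QCD.Theorems.RobustYangMillsHandover

/-! ## §1 Weaker intermediate: the crux is the weakest occupant of its slot -/

/-- Given the target, the open glue item `InterleavedFlowProper` (18031) holds outright. [folklore] -/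
theorem interleavedFlowProper_of_target (hX : ContinuumQCDExists) : InterleavedFlowProper :=
  fun _ _ _ _ => hX

/-- **Slot minimality.** If a statement `C'` can stand in for the crux as the last binder of a deciding
theorem with the route's other five binders, then `C'` implies the crux: the four closed binders are
theorems of the tree (cited by name) and `InterleavedFlowProper` follows from the target.  Hence every
admissible replacement is at least as strong as `RobustYangMillsHandover`; a strictly weaker
intermediate for this slot does not exist. [folklore] -/
theorem crux_of_replacement (C' : Prop)
    (closes' : SmallFieldUltracontractivity → ActionBoundsLowModes → TracedQuadraticParametrix →
      QuarkLoopCoefficient → InterleavedFlowProper → C' → _root_.QCD) :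
    C' → RobustYangMillsHandover :=
  fun hc hX =>
    closes'
      Summit.QuantumFields.QCD.Cruxes.SmallFieldUltracontractivity.PointCentredAxialParabolic.SmallFieldUltracontractivity_of
      Summit.QuantumFields.QCD.Cruxes.ActionBoundsLowModes.DropTheWilsonSquare.ActionBoundsLowModes_of
      Summit.QuantumFields.QCD.Cruxes.TracedQuadraticParametrix.Sketch.TracedQuadraticParametrix_of
      Summit.QuantumFields.QCD.Cruxes.QuarkLoopCoefficient.Sketch.QuarkLoopCoefficient_of
      (interleavedFlowProper_of_target hX) hc

/-- The binder-free form: whatever closes `QCD` from the target implies the crux. [folklore] -/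
theorem crux_of_replacement' (C' : Prop) (h : ContinuumQCDExists → C' → _root_.QCD) :
    C' → RobustYangMillsHandover :=
  fun hc hX => h hX hc

/-- Given the target, the crux IS the summit conjunct. [folklore] -/
theorem crux_iff_qcd_of_target (hX : ContinuumQCDExists) : RobustYangMillsHandover ↔ _root_.QCD :=
  ⟨fun h => h hX, fun h _ => h⟩

/-! ## §2 Decomposition: the seam lattice | continuum (shift-allowed form) -/

/-- **Lattice | continuum seam.**  Piece L (lattice side, may RE-CHOOSE the regularisation — e.g. the
`m_crit` re-pin of the live line): from a target-honest regularisation produce a target-honest one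
that is chiral at zero and lattice-gapped (some rate) at every positive tuple.  Piece C (continuum
side, 8923-type gap transfer with data re-choice): on any target-honest regularisation, a lattice gap
at a positive tuple yields continuum-gapped honest data there.  `L → C → crux`. [folklore] -/
theorem handover_of_latticeSide_continuumSide
    (hL : ∀ Nf : ℕ, Nf = 2 ∨ Nf = 3 →
      (∃ reg : QCDRegularisation Nf, reg.HasMassScaling ∧
        ∀ m : Fin Nf → ℝ, (∀ f, 0 < m f) →
          ∃ (z shift : QCDField Nf → ℕ → ℝ) (T : OSData (QCDField Nf) 4),
            IsQCDAlong (reg.scheme m z shift) T ∧ T.IsNontrivial QCDField.glue ∧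
              T.IsNonGaussian QCDField.glue ∧
                ∀ f g : Fin Nf, f ≠ g → T.IsNontrivial (QCDField.pseudoRe f g)) →
      ∃ reg : QCDRegularisation Nf, reg.HasMassScaling ∧
        (∀ m : Fin Nf → ℝ, (∀ f, 0 < m f) →
          ∃ (z shift : QCDField Nf → ℕ → ℝ) (T : OSData (QCDField Nf) 4),
            IsQCDAlong (reg.scheme m z shift) T ∧ T.IsNontrivial QCDField.glue ∧
              T.IsNonGaussian QCDField.glue ∧
                ∀ f g : Fin Nf, f ≠ g → T.IsNontrivial (QCDField.pseudoRe f g)) ∧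
        reg.IsChiralAtZero ∧
        ∀ m : Fin Nf → ℝ, (∀ f, 0 < m f) → ∃ Δ > 0, (reg.scheme m 0 0).HasLatticeMassGap Δ)
    (hC : ∀ Nf : ℕ, Nf = 2 ∨ Nf = 3 → ∀ reg : QCDRegularisation Nf, reg.HasMassScaling →
      (∀ m : Fin Nf → ℝ, (∀ f, 0 < m f) →
          ∃ (z shift : QCDField Nf → ℕ → ℝ) (T : OSData (QCDField Nf) 4),
            IsQCDAlong (reg.scheme m z shift) T ∧ T.IsNontrivial QCDField.glue ∧
              T.IsNonGaussian QCDField.glue ∧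
                ∀ f g : Fin Nf, f ≠ g → T.IsNontrivial (QCDField.pseudoRe f g)) →
      ∀ m : Fin Nf → ℝ, (∀ f, 0 < m f) →
        (∃ Δ > 0, (reg.scheme m 0 0).HasLatticeMassGap Δ) →
          ∃ (z shift : QCDField Nf → ℕ → ℝ) (T : OSData (QCDField Nf) 4),
            (IsQCDAlong (reg.scheme m z shift) T ∧ T.IsNontrivial QCDField.glue ∧
              T.IsNonGaussian QCDField.glue ∧
                ∀ f g : Fin Nf, f ≠ g → T.IsNontrivial (QCDField.pseudoRe f g)) ∧
            ∃ Δ > 0, T.HasMassGap Δ) :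
    RobustYangMillsHandover := by
  intro hX
  have key : ∀ Nf, Nf = 2 ∨ Nf = 3 → QCDOf Nf := by
    intro Nf hNf
    obtain ⟨reg, hms, hB, hchi, hgap⟩ := hL Nf hNf (hX Nf hNf)
    rw [Negative.qcdOf_iff_split_chiral]
    exact ⟨reg, hms, hchi, fun m hm => ⟨hC Nf hNf reg hms hB m hm (hgap m hm), hgap m hm⟩⟩
  exact ⟨key 2 (Or.inl rfl), key 3 (Or.inr rfl)⟩

/-- Piece L is a consequence of the summit conjunct (so it is not stronger than `S`). [folklore] -/
theorem latticeSide_of_qcd (h : _root_.QCD) :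
    ∀ Nf : ℕ, Nf = 2 ∨ Nf = 3 →
      (∃ reg : QCDRegularisation Nf, reg.HasMassScaling ∧
        ∀ m : Fin Nf → ℝ, (∀ f, 0 < m f) →
          ∃ (z shift : QCDField Nf → ℕ → ℝ) (T : OSData (QCDField Nf) 4),
            IsQCDAlong (reg.scheme m z shift) T ∧ T.IsNontrivial QCDField.glue ∧
              T.IsNonGaussian QCDField.glue ∧
                ∀ f g : Fin Nf, f ≠ g → T.IsNontrivial (QCDField.pseudoRe f g)) →
      ∃ reg : QCDRegularisation Nf, reg.HasMassScaling ∧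
        (∀ m : Fin Nf → ℝ, (∀ f, 0 < m f) →
          ∃ (z shift : QCDField Nf → ℕ → ℝ) (T : OSData (QCDField Nf) 4),
            IsQCDAlong (reg.scheme m z shift) T ∧ T.IsNontrivial QCDField.glue ∧
              T.IsNonGaussian QCDField.glue ∧
                ∀ f g : Fin Nf, f ≠ g → T.IsNontrivial (QCDField.pseudoRe f g)) ∧
        reg.IsChiralAtZero ∧
        ∀ m : Fin Nf → ℝ, (∀ f, 0 < m f) → ∃ Δ > 0, (reg.scheme m 0 0).HasLatticeMassGap Δ := by
  intro Nf hNf _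
  have hQ : QCDOf Nf := by
    rcases hNf with rfl | rfl
    · exact h.1
    · exact h.2
  obtain ⟨reg, hms, hchi, hb⟩ := (Negative.qcdOf_iff_split_chiral Nf).mp hQ
  refine ⟨reg, hms, fun m hm => ?_, hchi, fun m hm => (hb m hm).2⟩
  obtain ⟨⟨z, shift, T, hbody, -⟩, -⟩ := hb m hm
  exact ⟨z, shift, T, hbody⟩

/-! ## §3 Strengthen: the rigid same-regularisation form and why it is the wrong rigidity -/

/-- **`S⁺ → crux`.**  `S⁺`: EVERY target-honest regularisation is chiral at zero and carries, at every
positive tuple, honest data with both gap clauses. [folklore] -/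
theorem handover_of_sameRegStrong
    (hS : ∀ Nf : ℕ, Nf = 2 ∨ Nf = 3 → ∀ reg : QCDRegularisation Nf, reg.HasMassScaling →
      (∀ m : Fin Nf → ℝ, (∀ f, 0 < m f) →
          ∃ (z shift : QCDField Nf → ℕ → ℝ) (T : OSData (QCDField Nf) 4),
            IsQCDAlong (reg.scheme m z shift) T ∧ T.IsNontrivial QCDField.glue ∧
              T.IsNonGaussian QCDField.glue ∧
                ∀ f g : Fin Nf, f ≠ g → T.IsNontrivial (QCDField.pseudoRe f g)) →
      reg.IsChiralAtZero ∧
        ∀ m : Fin Nf → ℝ, (∀ f, 0 < m f) →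
          ∃ (z shift : QCDField Nf → ℕ → ℝ) (T : OSData (QCDField Nf) 4),
            IsQCDAlong (reg.scheme m z shift) T ∧ T.IsNontrivial QCDField.glue ∧
              T.IsNonGaussian QCDField.glue ∧
                (∀ f g : Fin Nf, f ≠ g → T.IsNontrivial (QCDField.pseudoRe f g)) ∧
                  ∃ Δ > 0, T.HasMassGap Δ ∧ (reg.scheme m z shift).HasLatticeMassGap Δ) :
    RobustYangMillsHandover := by
  intro hX
  have key : ∀ Nf, Nf = 2 ∨ Nf = 3 → QCDOf Nf := by
    intro Nf hNf
    obtain ⟨reg, hms, hB⟩ := hX Nf hNf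
    obtain ⟨hchi, hall⟩ := hS Nf hNf reg hms hB
    exact ⟨reg, hms, hchi, hall⟩
  exact ⟨key 2 (Or.inl rfl), key 3 (Or.inr rfl)⟩

/-- **`S⁺` is refuted by a uniform heavy floor.**  If some target-honest regularisation is uniformly
lattice-gapped (one rate `ε`) at every tuple above some threshold `M₀ ≥ 0` — the decoupled/heavy
regime in uniform form — then `S⁺` (even its chirality conjunct alone) is FALSE: the `m_crit`-shift by
`M₀` is again target-honest (`Negative.continuumQCDExists_iff_threshold`) but not chiral
(`Negative.not_isChiralAtZero_mcrit_shift_of_uniformGapAbove`).  So the rigidity `S⁺` adds over the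
crux is refutable by the very input the heavy half of every line wants; the honest rigid form must
re-choose the offset (pin `m_crit`), which is the live line, not a new one. [folklore] -/
theorem not_sameRegStrong_of_uniformFloor {Nf : ℕ} (hNf : Nf = 2 ∨ Nf = 3)
    (reg : QCDRegularisation Nf) (hms : reg.HasMassScaling) (M₀ : ℝ) (hM₀ : 0 ≤ M₀)
    (hB : ∀ m : Fin Nf → ℝ, (∀ f, M₀ < m f) →
      ∃ (z shift : QCDField Nf → ℕ → ℝ) (T : OSData (QCDField Nf) 4),
        IsQCDAlong (reg.scheme m z shift) T ∧ T.IsNontrivial QCDField.glue ∧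
          T.IsNonGaussian QCDField.glue ∧
            ∀ f g : Fin Nf, f ≠ g → T.IsNontrivial (QCDField.pseudoRe f g))
    {ε : ℝ} (hε : 0 < ε)
    (hfloor : ∀ m : Fin Nf → ℝ, (∀ f, M₀ < m f) → (reg.scheme m 0 0).HasLatticeMassGap ε) :
    ¬ (∀ Nf : ℕ, Nf = 2 ∨ Nf = 3 → ∀ reg : QCDRegularisation Nf, reg.HasMassScaling →
      (∀ m : Fin Nf → ℝ, (∀ f, 0 < m f) →
          ∃ (z shift : QCDField Nf → ℕ → ℝ) (T : OSData (QCDField Nf) 4),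
            IsQCDAlong (reg.scheme m z shift) T ∧ T.IsNontrivial QCDField.glue ∧
              T.IsNonGaussian QCDField.glue ∧
                ∀ f g : Fin Nf, f ≠ g → T.IsNontrivial (QCDField.pseudoRe f g)) →
      reg.IsChiralAtZero) := by
  intro hS
  have _ := hM₀
  -- the shifted regularisation is target-honest …
  set reg' : QCDRegularisation Nf :=
    { reg with mcrit := fun k => reg.mcrit k + reg.a k * M₀ / reg.Zm k } with hreg'
  have hms' : reg'.HasMassScaling := (Negative.hasMassScaling_mcrit_shift_iff reg M₀).mpr hms
  have hB' : ∀ m : Fin Nf → ℝ, (∀ f, 0 < m f) →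
      ∃ (z shift : QCDField Nf → ℕ → ℝ) (T : OSData (QCDField Nf) 4),
        IsQCDAlong (reg'.scheme m z shift) T ∧ T.IsNontrivial QCDField.glue ∧
          T.IsNonGaussian QCDField.glue ∧
            ∀ f g : Fin Nf, f ≠ g → T.IsNontrivial (QCDField.pseudoRe f g) := by
    intro m hm
    obtain ⟨z, shift, T, hQ, hN, hG, hP⟩ := hB (fun f => M₀ + m f) (fun f => by linarith [hm f])
    refine ⟨z, shift, T, ?_, hN, hG, hP⟩
    rwa [hreg', Theorems.GluonicCompletion.Negative.scheme_mcrit_shift]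
  -- … but not chiral at zero
  exact Negative.not_isChiralAtZero_mcrit_shift_of_uniformGapAbove reg M₀ hε hfloor
    (hS Nf hNf reg' hms' hB')

/-! ## §4 Negation: a counterexample to the crux contains a proof of the target -/

/-- [folklore] -/
theorem target_of_not_handover (h : ¬ RobustYangMillsHandover) : ContinuumQCDExists ∧ ¬ _root_.QCD :=
  Negative.not_handover_iff.mp h

end Summit.QuantumFields.QCD.Cruxes.RobustYangMillsHandover.CensusS8
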